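import Summits.QuantumAdvantage.QuantumAdvantage.Theses.ArithStatLadder
import Literature.Computability.Cryptography.HallgrenPell
import Literature.NumberTheory.QuadraticFields.ThreeTorsion
import Literature.NumberTheory.QuadraticFields.ThreeTorsionMean
import Literature.NumberTheory.CubicFields.ThreeTorsionBridge

/-!
# Sketch (crux-ideate, ideator 2) for crux `AvgFaceBeyondPrior` (stmt-QuantumAdvantage-2427)

First lemmas of the two idea cards `mirror-unit-signature` and `planted-cubic-top-rung`.
Everything is stated over existing declarations; `sorry` only in the two composition theorems
whose proofs are the lines themselves. Nothing here is a route item.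
-/

noncomputable section

open scoped Classical BigOperators Topology
open Filter

namespace Summit.QuantumAdvantage.QuantumAdvantage.Cruxes.AvgFaceBeyondPrior.Ideator2

open Literature.Computability.MetaComplexity Literature.Computability.Complexity
  Literature.Computability.Cryptography Literature.NumberTheory.QuadraticFields
  Summit.QuantumAdvantage.QuantumAdvantage.Theses.ArithStatLadder

/-! ### The crux, unpacked -/

/-- `-d` is a fundamental discriminant (the route's literal spelling). -/
def IsNegFund (d : ℕ) : Prop :=
  ((-(d:ℤ)) % 4 = 1 ∧ Squarefree (-(d:ℤ)) ∧ (-(d:ℤ)) ≠ 1) ∨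
    (4 ∣ (-(d:ℤ)) ∧ ((-(d:ℤ)) / 4 % 4 = 2 ∨ (-(d:ℤ)) / 4 % 4 = 3) ∧ Squarefree ((-(d:ℤ)) / 4))

/-- `𝒟_n`: the `n`-bit `d` with `-d` fundamental — the support of `U_n`. -/
def fundWindow (n : ℕ) : Finset ℕ :=
  (Finset.Ico (2 ^ (n - 1)) (2 ^ n)).filter fun d : ℕ => IsNegFund d

/-- `IQ3 = {bin d : -d fundamental, 3 ∣ h(-d)}`. -/
def IQ3 : Language Bool :=
  Computability.encodingNatBool.toLanguage
    {d : ℕ | IsNegFund d ∧ 3 ∣ BinaryQuadraticForm.classNumber (-(d:ℤ))}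

/-- `U_n` = uniform on `𝒟_n` (pushed to strings), `pure []` if empty. -/
def U : Ensemble := fun n =>
  if h : (fundWindow n).Nonempty then
    (PMF.uniformOfFinset (fundWindow n) h).map Computability.encodeNat
  else PMF.pure []

/-- The crux is `(IQ3, U) ∉ Heur_{1/3}BPP` (the route decl spells `IQ3`, `U` inline; the two
`DistProblem`s agree up to the `Decidable` instance chosen for the window's filter, so below the
crux is always named by the ROUTE decl `AvgFaceBeyondPrior`, never by this restatement). -/
def CruxRestated : Prop :=
  (⟨IQ3, U⟩ : DistProblem) ∉ HeurDeltaBPP (fun _ => (1 : ℝ) / 3)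

/-! ### Card `mirror-unit-signature` (Scholz–Leopoldt–Gras reflection with unit defect) -/

/-- The mirror discriminant `D⁺(d) = disc ℚ(√(3d))`: `3d` if `3 ∤ d`, `d/3` if `3 ∣ d`
(for `-d` fundamental; checked: both are fundamental discriminants). -/
def mirrorDisc (d : ℕ) : ℤ := if 3 ∣ d then ((d / 3 : ℕ) : ℤ) else 3 * (d : ℤ)

/-- `(a, b)` is the fundamental unit `ε = (a + b√D⁺)/2 > 1` of the ring of integers of `ℚ(√D⁺)`,
written arithmetically as in `JacobsonWilliams2008_unitResidue_mem_FP`. -/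
def IsFundUnit (d a b : ℕ) : Prop :=
  0 < b ∧ ((a:ℤ) ^ 2 - mirrorDisc d * (b:ℤ) ^ 2 = 4 ∨ (a:ℤ) ^ 2 - mirrorDisc d * (b:ℤ) ^ 2 = -4) ∧
    ∀ a' b' : ℕ, 0 < b' →
      ((a':ℤ) ^ 2 - mirrorDisc d * (b':ℤ) ^ 2 = 4 ∨ (a':ℤ) ^ 2 - mirrorDisc d * (b':ℤ) ^ 2 = -4) →
        a ≤ a'

/-- `Tr η` for `η = ε` (if `N ε = 1`) or `η = ε²` (if `N ε = -1`): `a`, resp. `a² + 2`. -/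
def mirrorTrace (d a b : ℕ) : ℤ :=
  if (a:ℤ) ^ 2 - mirrorDisc d * (b:ℤ) ^ 2 = 4 then (a : ℤ) else (a : ℤ) ^ 2 + 2

/-- **The unit signature.** `ε(ℚ(√D⁺))` is `3`-PRIMARY: the unit cubic `X³ - 3X - Tr η`
(whose roots are `η^{1/3} + η^{-1/3}`; quadratic resolvent `ℚ(√-d)`) cuts out a cubic field of
discriminant EXACTLY `-d`, i.e. the cyclic cubic extension `ℚ(√-d, η^{1/3}+η^{-1/3})/ℚ(√-d)` is
unramified also at `3` (Hecke: `η ≡ ξ³ (mod 𝔓³)`; numerically pinned by kit job j011009). -/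
def UnitIsThreePrimary (d : ℕ) : Prop :=
  ∃ a b : ℕ, IsFundUnit d a b ∧
    ∃ (F : Type) (_ : Field F) (_ : NumberField F),
      Module.finrank ℚ F = 3 ∧ NumberField.discr F = -(d:ℤ) ∧
        ∃ θ : F, θ ^ 3 - 3 * θ - (mirrorTrace d a b : F) = 0

/-- The mirror-unit language `L_P = {bin d : -d fundamental, P d}` for a signature predicate `P`. -/
def mirrorLang (P : ℕ → Prop) : Language Bool :=
  Computability.encodingNatBool.toLanguage {d : ℕ | IsNegFund d ∧ P d}

/-- `IQ3` and `L_P` disagree on at most `1/6 + ε` of `𝒟_n`, eventually. -/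
def MirrorAgreement (P : ℕ → Prop) : Prop :=
  ∀ ε : ℝ, 0 < ε → ∀ᶠ n : ℕ in atTop,
    ((((fundWindow n).filter fun d : ℕ =>
        ¬ (3 ∣ BinaryQuadraticForm.classNumber (-(d:ℤ)) ↔ P d)).card : ℝ))
      ≤ (1 / 6 + ε) * ((fundWindow n).card : ℝ)

/-- **Scholz 1932 / Leopoldt 1958 / Gras, the two facts the line uses** (for `-d` fundamental,
`K = ℚ(√-d, √-3)`, mirror pair `χ_{-d} ↔ χ_{3d}`): (i) a 3-primary unit yields an unramified
`C₃`-extension of `ℚ(√-d)`, so `3 ∣ h(-d)` (`L_ε ⊆ IQ3`, exact); (ii) if `r₃(D⁺) = 0` then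
`r₃(-d) = 1 - ρ` with `ρ = [ε not 3-primary]`, so `3 ∣ h(-d) → ε primary`. In general
`r₃(-d) = r₃(D⁺) + 1 - ρ(d)`, `ρ ∈ {0,1}`. To be vendored as a named Literature fact (CFT). -/
def ScholzGrasMirror : Prop :=
  ∀ d : ℕ, IsNegFund d →
    (UnitIsThreePrimary d → 3 ∣ BinaryQuadraticForm.classNumber (-(d:ℤ))) ∧
    (quadFieldThreeTorsion (mirrorDisc d) = 1 →
      3 ∣ BinaryQuadraticForm.classNumber (-(d:ℤ)) → UnitIsThreePrimary d)

/-- **Davenport–Heilbronn for the mirror family**: `r₃(D⁺(d)) ≥ 1` for at most `1/6 + ε` of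
`d ∈ 𝒟_n` eventually (mean `4/3` of `#Cl₃` over real quadratic fields with the local condition
`3 ∥ D⁺` on `[3·2^{n-1}, 3·2ⁿ)` and `3 ∤ D⁺` on `[2^{n-1}/3, 2ⁿ/3)`; BST Thm 6/25 with Σ₃, in print). -/
def MirrorRankRare : Prop :=
  ∀ ε : ℝ, 0 < ε → ∀ᶠ n : ℕ in atTop,
    ((((fundWindow n).filter fun d : ℕ => quadFieldThreeTorsion (mirrorDisc d) ≠ 1).card : ℝ))
      ≤ (1 / 6 + ε) * ((fundWindow n).card : ℝ)

/-- **First lemma of the card (proved): reflection + DH-real ⇒ `IQ3 = L_ε` off `1/6 + ε`.** -/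
theorem mirrorAgreement_of (hS : ScholzGrasMirror) (hR : MirrorRankRare) :
    MirrorAgreement UnitIsThreePrimary := by
  intro ε hε
  filter_upwards [hR ε hε] with n hn
  refine le_trans ?_ hn
  have hsub : ((fundWindow n).filter fun d : ℕ =>
        ¬ (3 ∣ BinaryQuadraticForm.classNumber (-(d:ℤ)) ↔ UnitIsThreePrimary d))
      ⊆ ((fundWindow n).filter fun d : ℕ => quadFieldThreeTorsion (mirrorDisc d) ≠ 1) := by
    intro d hd
    rw [Finset.mem_filter] at hd ⊢
    refine ⟨hd.1, fun h1 => hd.2 ?_⟩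
    have hf : IsNegFund d := (Finset.mem_filter.1 hd.1).2
    exact ⟨fun h3 => (hS d hf).2 h1 h3, fun hP => (hS d hf).1 hP⟩
  exact_mod_cast Finset.card_le_card hsub

/-- The quantum half: `L_ε ∈ BQP`, GRH-free (Shor for fundamentality of `-d`; the tree's PROVED
`Hallgren2007_regulator_qsolvable_holds`; `JacobsonWilliams2008_unitResidue_mem_FP` at `m = 54`;
a finite table deciding 3-primarity from `(a, b) mod 54` and `d mod 27`). -/
def MirrorUnitMemBQP : Prop :=
  mirrorLang UnitIsThreePrimary ∈ BQP

/-- Heuristic-class plumbing (generic; `distClass_BPP_subset_HeurBPP` + hard-coding small `n`):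
a `BPP` language that agrees with `IQ3` off `≤ 1/6 + ε` of `U_n` for large `n` puts `(IQ3, U)` in
`Heur_{1/3}BPP`, i.e. refutes the crux (stated against the ROUTE decl). -/
def HeurTransfer : Prop :=
  ∀ P : ℕ → Prop, MirrorAgreement P → mirrorLang P ∈ BPP → ¬ AvgFaceBeyondPrior

/-- **TRANSFER OF ROLE (proved): with the mirror items the crux ALONE decides the summit, no GRH.** -/
theorem closes_of_mirror (hT : HeurTransfer) (hA : MirrorAgreement UnitIsThreePrimary)
    (hQ : MirrorUnitMemBQP) (h : AvgFaceBeyondPrior) : QuantumAdvantage := by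
  by_contra hno
  have hBPP : mirrorLang UnitIsThreePrimary ∈ BPP := by
    by_contra hB
    exact hno ⟨_, hQ, hB⟩
  exact hT _ hA hBPP h

/-! ### Card `planted-cubic-top-rung` (planted cubic discriminants; the uniform PPT rung) -/

/-- Hasse's CFT dictionary on the ensemble (the hypothesis of `ThreeTorsionBridge`):
`#Cl₃(-d) = 2·#{cubic fields of discriminant -d} + 1`. -/
def CubicDictionary : Prop :=
  ∀ d : ℕ, IsNegFund d →
    quadFieldThreeTorsion (-(d:ℤ)) =
      2 * Literature.NumberTheory.CubicFields.cubicFieldCountOfDisc (-(d:ℤ)) + 1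

/-- Davenport–Heilbronn on dyadic windows (from `btt_threeTorsion_sum` differenced). -/
def WindowMeanTwo : Prop :=
  Tendsto (fun n : ℕ =>
    (∑ d ∈ fundWindow n, (quadFieldThreeTorsion (-(d:ℤ)) : ℝ)) / ((fundWindow n).card : ℝ))
    atTop (𝓝 2)

/-- **The load-bearing hypothesis `PPTRung`** (= pseudorandomness of planted cubic discriminants):
no PPT statistic of `d` correlates with the centred 3-torsion along `𝒟_n` — the top, uniform rung
of the route's ladder `EndJuntaRung ⊂ DigitRung ⊂ AcZeroRung ⊂ … ⊂ PPTRung`. Separation-strength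
(it implies the crux, hence `P ≠ PSPACE`): hypothesis-type. -/
def PPTRung : Prop :=
  ∀ A : RandAlg (List Bool × ℕ) Bool, A.IsPolyTime paramEnc Computability.encodeBool →
    ∀ ε : ℝ, 0 < ε → ∀ᶠ n : ℕ in atTop,
      |∑ d ∈ fundWindow n, ((quadFieldThreeTorsion (-(d:ℤ)) : ℝ) - 2) *
          A.pr paramEnc (Computability.encodeNat d, n) {true}|
        ≤ ε * ((fundWindow n).card : ℝ)

/-- The arithmetic side condition: `3 ∣ h(-d)` has density `> 1/3` on `𝒟_n` infinitely often
(Cohen–Lenstra: `0.43987…`; OPEN — Heath-Brown 2007 gives only `≫ X^{9/10}` discriminants). -/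
def DensityAboveThird : Prop :=
  ∃ η : ℝ, 0 < η ∧ ∃ᶠ n : ℕ in atTop,
    ((1 : ℝ) / 3 + η) * ((fundWindow n).card : ℝ) ≤
      ((((fundWindow n).filter fun d : ℕ => 3 ∣ BinaryQuadraticForm.classNumber (-(d:ℤ))).card : ℝ))

/-- **First lemma of the card (finite advantage lemma, pure combinatorics):** for weights
`t ≥ 1` with `t ≠ 1 → t ≥ 3` (here `t = 3^{r₃}`), members `S = {t ≠ 1}`, planted weight `t - 1`,
total `W = Σ (t - 1) ≤ 2N`, and any `[0,1]`-statistic `g` that equals `1_S` off a bad set `B`: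
`Σ (t-1) g / W - Σ g / N ≥ 2 |S ∖ B| / W - (|S ∖ B| + |B ∖ S|) / N` (`= |S|/N - |B|/N` when `W = N`).
So a `δ`-heuristic decider distinguishes planted from null with advantage `≥ dens(IQ3) - δ - o(1)`. -/
theorem advantage_lemma (F B : Finset ℕ) (hBF : B ⊆ F) (t : ℕ → ℕ)
    (ht : ∀ d ∈ F, 1 ≤ t d) (hgap : ∀ d ∈ F, t d ≠ 1 → 3 ≤ t d)
    (g : ℕ → ℝ) (hg0 : ∀ d, 0 ≤ g d) (hg1 : ∀ d, g d ≤ 1)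
    (hgood : ∀ d ∈ F \ B, g d = if t d = 1 then 0 else 1)
    (hW : 0 < ∑ d ∈ F, ((t d : ℝ) - 1)) (hW2 : ∑ d ∈ F, ((t d : ℝ) - 1) ≤ 2 * (F.card : ℝ)) :
    2 * ((((F \ B).filter fun d : ℕ => t d ≠ 1).card : ℝ)) / (∑ d ∈ F, ((t d : ℝ) - 1))
        - (((((F \ B).filter fun d : ℕ => t d ≠ 1).card : ℝ)) + (((B.filter fun d : ℕ => t d = 1).card : ℝ)))
            / (F.card : ℝ)
      ≤ (∑ d ∈ F, ((t d : ℝ) - 1) * g d) / (∑ d ∈ F, ((t d : ℝ) - 1))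
          - (∑ d ∈ F, g d) / (F.card : ℝ) := by
  -- N > 0
  have hFne : F.Nonempty := by
    by_contra hF
    rw [Finset.not_nonempty_iff_eq_empty] at hF
    simp [hF] at hW
  have hN : (0 : ℝ) < (F.card : ℝ) := by exact_mod_cast Finset.card_pos.2 hFne
  -- pointwise facts
  have hS'mem : ∀ d ∈ (F \ B).filter (fun d : ℕ => t d ≠ 1), d ∈ F ∧ d ∉ B ∧ t d ≠ 1 := fun d hd => by
    have h := Finset.mem_filter.1 hd
    exact ⟨(Finset.mem_sdiff.1 h.1).1, (Finset.mem_sdiff.1 h.1).2, h.2⟩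
  have hgS' : ∀ d ∈ (F \ B).filter (fun d : ℕ => t d ≠ 1), g d = 1 := fun d hd => by
    obtain ⟨hF, hB, h1⟩ := hS'mem d hd
    have := hgood d (Finset.mem_sdiff.2 ⟨hF, hB⟩)
    simpa [h1] using this
  have htS' : ∀ d ∈ (F \ B).filter (fun d : ℕ => t d ≠ 1), (2 : ℝ) ≤ (t d : ℝ) - 1 := fun d hd => by
    obtain ⟨hF, -, h1⟩ := hS'mem d hd
    have h3 : ((3 : ℕ) : ℝ) ≤ (t d : ℝ) := by exact_mod_cast hgap d hF h1
    push_cast at h3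
    linarith
  have htB₂ : ∀ d ∈ B.filter (fun d : ℕ => t d ≠ 1), (2 : ℝ) ≤ (t d : ℝ) - 1 := fun d hd => by
    have h := Finset.mem_filter.1 hd
    have h3 : ((3 : ℕ) : ℝ) ≤ (t d : ℝ) := by exact_mod_cast hgap d (hBF h.1) h.2
    push_cast at h3
    linarith
  have ht1 : ∀ d ∈ F, (0 : ℝ) ≤ (t d : ℝ) - 1 := fun d hd => by
    have : ((1 : ℕ) : ℝ) ≤ (t d : ℝ) := by exact_mod_cast ht d hd
    push_cast at this
    linarith
  -- (E) planted sum, lower bound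
  have hE : (∑ d ∈ (F \ B).filter (fun d : ℕ => t d ≠ 1), ((t d : ℝ) - 1))
      + ∑ d ∈ B.filter (fun d : ℕ => t d ≠ 1), ((t d : ℝ) - 1) * g d
      ≤ ∑ d ∈ F, ((t d : ℝ) - 1) * g d := by
    have h1 : ∑ d ∈ (F \ B).filter (fun d : ℕ => t d ≠ 1), ((t d : ℝ) - 1)
        = ∑ d ∈ (F \ B).filter (fun d : ℕ => t d ≠ 1), ((t d : ℝ) - 1) * g d := by
      refine Finset.sum_congr rfl fun d hd => ?_
      rw [hgS' d hd, mul_one]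
    have h2 : 0 ≤ ∑ d ∈ (F \ B).filter (fun d : ℕ => ¬ t d ≠ 1), ((t d : ℝ) - 1) * g d :=
      Finset.sum_nonneg fun d hd =>
        mul_nonneg (ht1 d (Finset.mem_sdiff.1 (Finset.mem_filter.1 hd).1).1) (hg0 d)
    have h3 : 0 ≤ ∑ d ∈ B.filter (fun d : ℕ => ¬ t d ≠ 1), ((t d : ℝ) - 1) * g d :=
      Finset.sum_nonneg fun d hd => mul_nonneg (ht1 d (hBF (Finset.mem_filter.1 hd).1)) (hg0 d)
    have hsplit : ∑ d ∈ F, ((t d : ℝ) - 1) * g d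
        = (∑ d ∈ (F \ B).filter (fun d : ℕ => t d ≠ 1), ((t d : ℝ) - 1) * g d
            + ∑ d ∈ (F \ B).filter (fun d : ℕ => ¬ t d ≠ 1), ((t d : ℝ) - 1) * g d)
          + (∑ d ∈ B.filter (fun d : ℕ => t d ≠ 1), ((t d : ℝ) - 1) * g d
            + ∑ d ∈ B.filter (fun d : ℕ => ¬ t d ≠ 1), ((t d : ℝ) - 1) * g d) := by
      rw [Finset.sum_filter_add_sum_filter_not, Finset.sum_filter_add_sum_filter_not,
        Finset.sum_sdiff hBF]
    rw [hsplit, h1]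
    linarith
  -- (U) null sum, upper bound
  have hU : ∑ d ∈ F, g d ≤ ((((F \ B).filter fun d : ℕ => t d ≠ 1).card : ℝ))
      + (((B.filter fun d : ℕ => t d = 1).card : ℝ)) + ∑ d ∈ B.filter (fun d : ℕ => t d ≠ 1), g d := by
    have h1 : ∑ d ∈ (F \ B).filter (fun d : ℕ => t d ≠ 1), g d
        = ((((F \ B).filter fun d : ℕ => t d ≠ 1).card : ℝ)) := by
      rw [Finset.sum_congr rfl (fun d hd => hgS' d hd), Finset.sum_const, nsmul_eq_mul, mul_one]
    have h2 : ∑ d ∈ (F \ B).filter (fun d : ℕ => ¬ t d ≠ 1), g d = 0 := by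
      refine Finset.sum_eq_zero fun d hd => ?_
      have h := Finset.mem_filter.1 hd
      have h1' : t d = 1 := not_ne_iff.1 h.2
      have := hgood d h.1
      simpa [h1'] using this
    have h3 : ∑ d ∈ B.filter (fun d : ℕ => ¬ t d ≠ 1), g d ≤ (((B.filter fun d : ℕ => t d = 1).card : ℝ)) := by
      rw [Finset.filter_congr (s := B) (fun d _ => (not_ne_iff : ¬ t d ≠ 1 ↔ t d = 1))]
      calc ∑ d ∈ B.filter (fun d : ℕ => t d = 1), g d
          ≤ ∑ d ∈ B.filter (fun d : ℕ => t d = 1), (1 : ℝ) := Finset.sum_le_sum fun d _ => hg1 d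
        _ = (((B.filter fun d : ℕ => t d = 1).card : ℝ)) := by
          rw [Finset.sum_const, nsmul_eq_mul, mul_one]
    have hsplit : ∑ d ∈ F, g d
        = (∑ d ∈ (F \ B).filter (fun d : ℕ => t d ≠ 1), g d
            + ∑ d ∈ (F \ B).filter (fun d : ℕ => ¬ t d ≠ 1), g d)
          + (∑ d ∈ B.filter (fun d : ℕ => t d ≠ 1), g d
            + ∑ d ∈ B.filter (fun d : ℕ => ¬ t d ≠ 1), g d) := by
      rw [Finset.sum_filter_add_sum_filter_not, Finset.sum_filter_add_sum_filter_not,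
        Finset.sum_sdiff hBF]
    rw [hsplit, h1, h2]
    linarith
  -- (S) members outside B weigh at least 2 each
  have hS2 : 2 * ((((F \ B).filter fun d : ℕ => t d ≠ 1).card : ℝ))
      ≤ ∑ d ∈ (F \ B).filter (fun d : ℕ => t d ≠ 1), ((t d : ℝ) - 1) := by
    calc 2 * ((((F \ B).filter fun d : ℕ => t d ≠ 1).card : ℝ))
        = ∑ d ∈ (F \ B).filter (fun d : ℕ => t d ≠ 1), (2 : ℝ) := by
          rw [Finset.sum_const, nsmul_eq_mul, mul_comm]
      _ ≤ _ := Finset.sum_le_sum htS'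
  -- (B2) on bad members the planted weight dominates: W g ≤ N (t-1) g
  have hB2 : (∑ d ∈ F, ((t d : ℝ) - 1)) * ∑ d ∈ B.filter (fun d : ℕ => t d ≠ 1), g d
      ≤ (F.card : ℝ) * ∑ d ∈ B.filter (fun d : ℕ => t d ≠ 1), ((t d : ℝ) - 1) * g d := by
    rw [Finset.mul_sum, Finset.mul_sum]
    refine Finset.sum_le_sum fun d hd => ?_
    have hp : 0 ≤ g d * ((t d : ℝ) - 1 - 2) := mul_nonneg (hg0 d) (sub_nonneg.2 (htB₂ d hd))
    nlinarith [hp, hN.le, hW2, hg0 d]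
  -- combine
  have hE' := mul_le_mul_of_nonneg_right hE hN.le
  have hU' := mul_le_mul_of_nonneg_left hU hW.le
  have hS2' := mul_le_mul_of_nonneg_right hS2 hN.le
  have hmain : 2 * ((((F \ B).filter fun d : ℕ => t d ≠ 1).card : ℝ)) * (F.card : ℝ)
      - (∑ d ∈ F, ((t d : ℝ) - 1)) *
        (((((F \ B).filter fun d : ℕ => t d ≠ 1).card : ℝ)) + (((B.filter fun d : ℕ => t d = 1).card : ℝ)))
      ≤ (∑ d ∈ F, ((t d : ℝ) - 1) * g d) * (F.card : ℝ) - (∑ d ∈ F, ((t d : ℝ) - 1)) * (∑ d ∈ F, g d) := by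
    nlinarith [hE', hU', hS2', hB2]
  rw [div_sub_div _ _ hW.ne' hN.ne', div_sub_div _ _ hW.ne' hN.ne']
  exact div_le_div_of_nonneg_right hmain (by positivity)

/-- **Composition (the line): `PPTRung ∧ density > 1/3 ⇒ AvgFaceBeyondPrior`** (with the two
Davenport–Heilbronn/CFT inputs). Proof route: a `Heur_{1/3}` decider `A`, amplified, gives the
statistic `g(d) = Pr[A(d)=1]`; `advantage_lemma` with `B` = bad set and `WindowMeanTwo` give
`|Σ_{𝒟_n}(t-2)·g| ≥ (dens - 1/3 - o(1))·#𝒟_n ≥ (η/2)·#𝒟_n` frequently, contradicting `PPTRung`. -/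
theorem avgFaceBeyondPrior_of_pptRung (hΔ : CubicDictionary) (hM : WindowMeanTwo) (hR : PPTRung)
    (hD : DensityAboveThird) : AvgFaceBeyondPrior := by
  sorry

/-! ### The barrier, recorded: the crux is separation-strength -/

/-- `BPP ⊆ Heur_δBPP` for every ensemble and every `δ ≥ 0` (content of
`distClass_BPP_subset_HeurBPP`, fixed-`δ` form). -/
def BPPSubsetHeurDelta : Prop :=
  ∀ (L : Language Bool) (D : Ensemble) (δ : ℕ → ℝ), (∀ n, 0 ≤ δ n) → L ∈ BPP →
    (⟨L, D⟩ : DistProblem) ∈ HeurDeltaBPP δ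

/-- The restated crux implies `IQ3 ∉ BPP` — with `IQ3 ∈ P^{#P} ⊆ PSPACE` this is `BPP ≠ PSPACE`:
the catalogued `Literature.Barriers.QuantumAdvantage.SeparationPrerequisites` bites every proving
line (each card names its load-bearing hypothesis stub accordingly). -/
theorem iq3_not_mem_BPP_of_crux (hB : BPPSubsetHeurDelta) (h : CruxRestated) : IQ3 ∉ BPP :=
  fun hL => h (hB IQ3 U _ (fun _ => by norm_num) hL)

end Summit.QuantumAdvantage.QuantumAdvantage.Cruxes.AvgFaceBeyondPrior.Ideator2

end
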